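import Literature.MathematicalPhysics.QuantumFieldTheory.Balaban1983to89.B8Prop5ContractionKLevel
import Literature.MathematicalPhysics.QuantumFieldTheory.Balaban1983to89.B8Thm4Windows
import Literature.MathematicalPhysics.QuantumFieldTheory.Balaban1983to89.B8Ineq125Concrete
import Literature.MathematicalPhysics.QuantumFieldTheory.Balaban1983to89.B7ConclGaugeLin

/-!
# `Balaban1983to89.B8SockHFPWindows` — [Balaban1985RegularSpaces] Prop. 5 p. 94 / Thm 4 p. 88 «there exists a constant c₁»: THE SCALAR WINDOWS of the
# tranche-2 assembly `B8SockHFPAssembly.sockHFP_body_of_join` / `sockHFP₀_body_of_join` FROM ONE GUARD `α₀ + α₁ ≤ cP` and ONE free-constant condition on the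
# socket's `B₀′`

statement-level skeleton of published theorems with citation tags; proofs where landed; nothing here is a claim about the
Yang–Mills mass gap

PDF held: `paper:balaban1985-cmp99-regular-spaces-gauge-fixing` (journal page = PDF page + 74); p. 88 (Thm 4: «there exists a constant c₁ … such that for
α₀ + α₁ ≤ c₁»), p. 93 ((1.102)–(1.103): «for α₄ sufficiently small, e.g. B_G·M ≤ α₄/4», «α₄ = 8B₀′B₁(α₀ + α₁)»), p. 94 ((1.106)).

WHY THIS FILE (cell `pub-ymgap`, R134 acceleration seat `pub-ymgap-dag-n05-d`, strategy s2 of DAG node N05 = [B8]; dag-lead REBALANCE №51 (γ): the windows theorem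
under this seat's name — `pub-ymgap-dag-n19-b`'s reserved `joinWindows_of_guard` is untouched; count-neutral).  `B8SockHFPAssembly.sockHFP_body_of_join` (p451539)
displays the scalar windows of the Sect. D/E JOIN one-for-one (`hα3 hα4 hsmall hc₃ hsc hα₃' hs₁…hs₇ hsm hprod8 hcA' ha₁' hb₁' hθ h103 h106`) plus four of Proposition 3's
(`hside hC₂ h61 hsmall₁`) and the b9 thresholds, at `c⋆ = 5dLB₀(α₀ + α₁)`, `α₄ = 8B₀′c⋆`, `c_B = c_A = L·c⋆`, `c_DA = 2dL²·c⋆`, `h_E, h_E₂, l_E, l_E₂` the Sect. E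
sizes.  Every one of them is «a positive quantity, polynomial in `α₀ + α₁` and vanishing with it, below a constant» EXCEPT (1.103) `B_G·M ≤ α₄/4`, whose leading term
`B_G·B_R·(12/5)·c_DA` is LINEAR in `α₀ + α₁` like `α₄/4 = 2B₀′c⋆`: it closes iff the SOCKET's constant `B₀′` dominates `(6/5)·2dL²·B_G·B_R` — print p. 93 takes
`α₄ = 8B₀′B₁(α₀ + α₁)` with `B₀′` the constant of (1.92) AFTER «RD*A subtracted»; in the tree's currency (`pub-ymgap-dag-n05-a` LOCATED-1 (γ), D4 note) `B₀′` is a FREE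
constant of the socket and the condition is the displayed hypothesis `hfree : 3·(2dL²)·B_G·B_R ≤ B₀′`.  THIS FILE proves: below ONE threshold
`cP(d, L, B₀, B₀′, B₀′_H, B₂′, B_G, B_R, c_b9) > 0` all 27 windows hold — Theorem 4's «there exists a constant c₁» for the knit with the Prop-5 socket opened.

WHAT THIS FILE PROVES (kernel, 0 sorry, theorems only): §0 `C2p_pos` (constant; `two_le_C6'`, `C4G_pos'` are `B7ConclGaugeLin`'s); §1 `mWc_mono`, `KWc_mono` (the sizes `m_W`, `K_W` of
`B8Prop5ContractionKLevel` are monotone in their nonnegative arguments); §2 **`hfpWindows_of_guard`** — the 27 windows from the guard, device = `B8Thm4Windows.thm4_windows`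
(eighteen of them, BY NAME) + `mul_le_one_of_le_inv` for the rest (`cP := min c₁ (1/M)`, `M` = the sum of the coefficients).

HONEST SCOPE.  Scalar bookkeeping only («there exists a constant»); the constants are the lineage's, sufficient, not optimal.  Count-neutral; N05 NOT discharged;
one finite T⁴ programme at fixed ε; nothing continuum / ℝ⁴ / OS / mass-gap / Clay.  Unit `pub-ymgap-dag-n05-d` (g0), 2026-08-26.
-/

noncomputable section

namespace Literature.MathematicalPhysics.QuantumFieldTheory.Balaban1983to89.B8SockHFPWindows

open B7Prop2Explicit (C0 c2' C0_pos c2'_pos)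
open B7Prop3Flat (c3 c3_pos)
open B7Prop10General (C6 C7 C4G)
open B7Prop9Flat (C5')
open B7Prop10Flat (one_le_C5 C4'_nonneg C5'_nonneg)
open B7Eq214General (Cgen)
open B8Ineq125Concrete (C2p)
open B8Prop5ContractionKLevel (mWc Mc KWc Kc)
open B8Thm4Windows (mul_le_one_of_le_inv exp_le_of_small thm4_windows)
open B7ConclGaugeLin (two_le_C6' C4G_pos')

variable {d L : ℕ}

/-! ## §0 Constants -/

/-- `C′₂ > 0` (`C′₂ = 16·8832(d+1)C₆`, `C₆ ≥ 2` by `B7ConclGaugeLin.two_le_C6'`). [cite: Balaban1985RegularSpaces, (1.121) p.96 (the constant C′₂)] -/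
theorem C2p_pos : (0 : ℝ) < C2p d := by
  have h := two_le_C6' (d := d)
  unfold C2p Cgen; positivity

/-! ## §1 Monotonicity of the sizes `m_W` ((1.99)) and `K_W` ((1.106)) in their nonnegative arguments -/

/-- `m_W(b₁, c_A, m_E, c_DA) = (6/5)c_DA + 2m_E + d(82b₁² + 34c_Ab₁)` is monotone in `b₁, c_A ≥ 0`, `m_E`, `c_DA`.
[cite: Balaban1985RegularSpaces, (1.99) p.93] -/
theorem mWc_mono {b₁ b₁' cA cA' mE mE' cDA cDA' : ℝ} (hb : 0 ≤ b₁) (hbb : b₁ ≤ b₁') (hc : 0 ≤ cA) (hcc : cA ≤ cA') (hm : mE ≤ mE')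
    (hD : cDA ≤ cDA') : mWc d b₁ cA mE cDA ≤ mWc d b₁' cA' mE' cDA' := by
  unfold mWc
  have hd : (0 : ℝ) ≤ d := Nat.cast_nonneg d
  have h1 : b₁ ^ 2 ≤ b₁' ^ 2 := pow_le_pow_left₀ hb hbb 2
  have h2 : cA * b₁ ≤ cA' * b₁' := mul_le_mul hcc hbb hb (hc.trans hcc)
  have h3 : (d : ℝ) * (82 * b₁ ^ 2 + 34 * cA * b₁) ≤ d * (82 * b₁' ^ 2 + 34 * cA' * b₁') :=
    mul_le_mul_of_nonneg_left (by nlinarith only [h1, h2]) hd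
  linarith only [h3, hm, hD]

/-- `K_W(b₁, c_A, m_E, c_DA, K_E, ℓ₀, ℓ₁) = 18c_DAℓ₀ + 2K_E + 10m_Eℓ₀ + d(438b₁ℓ₁ + 1968b₁²ℓ₀ + 68c_Aℓ₁ + 808c_Ab₁ℓ₀)` is monotone in its arguments when
`b₁, c_A, m_E, c_DA, ℓ₀, ℓ₁ ≥ 0`. [cite: Balaban1985RegularSpaces, (1.106) p.94] -/
theorem KWc_mono {b₁ b₁' cA cA' mE mE' cDA cDA' KE KE' ℓ₀ ℓ₀' ℓ₁ ℓ₁' : ℝ} (hb : 0 ≤ b₁) (hbb : b₁ ≤ b₁') (hc : 0 ≤ cA) (hcc : cA ≤ cA')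
    (hm0 : 0 ≤ mE) (hm : mE ≤ mE') (hD0 : 0 ≤ cDA) (hD : cDA ≤ cDA') (hK : KE ≤ KE') (hl0 : 0 ≤ ℓ₀) (hl : ℓ₀ ≤ ℓ₀') (hm1 : 0 ≤ ℓ₁)
    (hl1 : ℓ₁ ≤ ℓ₁') : KWc d b₁ cA mE cDA KE ℓ₀ ℓ₁ ≤ KWc d b₁' cA' mE' cDA' KE' ℓ₀' ℓ₁' := by
  unfold KWc
  have hd : (0 : ℝ) ≤ d := Nat.cast_nonneg d
  have hb' : 0 ≤ b₁' := hb.trans hbb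
  have hc' : 0 ≤ cA' := hc.trans hcc
  have hl0' : 0 ≤ ℓ₀' := hl0.trans hl
  have hm1' : 0 ≤ ℓ₁' := hm1.trans hl1
  have t1 : cDA * ℓ₀ ≤ cDA' * ℓ₀' := mul_le_mul hD hl hl0 (hD0.trans hD)
  have t2 : mE * ℓ₀ ≤ mE' * ℓ₀' := mul_le_mul hm hl hl0 (hm0.trans hm)
  have t3 : b₁ * ℓ₁ ≤ b₁' * ℓ₁' := mul_le_mul hbb hl1 hm1 hb'
  have t4 : b₁ ^ 2 * ℓ₀ ≤ b₁' ^ 2 * ℓ₀' := mul_le_mul (pow_le_pow_left₀ hb hbb 2) hl hl0 (by positivity)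
  have t5 : cA * ℓ₁ ≤ cA' * ℓ₁' := mul_le_mul hcc hl1 hm1 hc'
  have t6 : cA * b₁ * ℓ₀ ≤ cA' * b₁' * ℓ₀' := mul_le_mul (mul_le_mul hcc hbb hb hc') hl hl0 (by positivity)
  have t7 : (d : ℝ) * (438 * b₁ * ℓ₁ + 1968 * b₁ ^ 2 * ℓ₀ + 68 * cA * ℓ₁ + 808 * cA * b₁ * ℓ₀) ≤
      d * (438 * b₁' * ℓ₁' + 1968 * b₁' ^ 2 * ℓ₀' + 68 * cA' * ℓ₁' + 808 * cA' * b₁' * ℓ₀') :=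
    mul_le_mul_of_nonneg_left (by linarith only [t3, t4, t5, t6]) hd
  linarith only [t1, t2, t7, hK]

/-! ## §2 The two nonlinear windows, (1.103) and (1.106), at the scales of the assembly -/

/-- **(1.103) `B_G·M ≤ α₄/4` at the scales of the assembly** (`M = B_R·2m_W`, `m_W = (6/5)c_DA + 2m_E + d(82b₁² + 34c_Ab₁)`): with `c_DA = K_DA·S`,
`K_DA = 2dL²·K₁`, `α₄/4 = 2B₀′K₁·S`, `b₁ ≤ K_b₁·S`, `c_A = K_b·S`, `m_E = K_hE₂·S²`, the leading term `B_G·B_R·(12/5)K_DA·S ≤ (4/5)·2B₀′K₁·S` by the free-constant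
condition `3·(2dL²)·B_G·B_R ≤ B₀′` and the remainder `2B_G·B_R·R·S² ≤ (6/5)B₀′K₁·S` below the threshold `(2B_G·B_R·R/((6/5)B₀′K₁))·S ≤ 1`.
[cite: Balaban1985RegularSpaces, (1.102)–(1.103) p.93 («for α₄ sufficiently small, e.g. B_G·M ≤ α₄/4»), (1.99) p.93] -/
theorem h103_of_scales {BG BR B₀' K₁ Kb Kb₁ KhE₂ KDA R S b₁ cA mE cDA a : ℝ} (hBG : 0 ≤ BG) (hBR : 0 ≤ BR) (hB₀' : 0 < B₀') (hK₁ : 0 < K₁)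
    (hS0 : 0 ≤ S) (hfree : 3 * (2 * (d : ℝ) * (L : ℝ) ^ 2) * BG * BR ≤ B₀') (hKDA : KDA = 2 * (d : ℝ) * (L : ℝ) ^ 2 * K₁)
    (hb₁0 : 0 ≤ b₁) (hb₁S : b₁ ≤ Kb₁ * S) (hcA0 : 0 ≤ cA) (hcAS : cA ≤ Kb * S) (hmES : mE ≤ KhE₂ * S ^ 2) (hcDAS : cDA ≤ KDA * S)
    (hR : R = 2 * KhE₂ + d * (82 * Kb₁ ^ 2 + 34 * Kb * Kb₁)) (e20 : 2 * BG * BR * R / (6 / 5 * B₀' * K₁) * S ≤ 1)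
    (ha : a = 2 * B₀' * K₁ * S) : BG * Mc d BR b₁ cA mE cDA ≤ a := by
  have hmW : mWc d b₁ cA mE cDA ≤ mWc d (Kb₁ * S) (Kb * S) (KhE₂ * S ^ 2) (KDA * S) := mWc_mono hb₁0 hb₁S hcA0 hcAS hmES hcDAS
  have hmaj : mWc d (Kb₁ * S) (Kb * S) (KhE₂ * S ^ 2) (KDA * S) = 6 / 5 * KDA * S + R * S ^ 2 := by
    rw [hR]; unfold mWc; ring
  have hM1 : BG * Mc d BR b₁ cA mE cDA ≤ BG * (BR * (2 * (6 / 5 * KDA * S + R * S ^ 2))) := by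
    unfold Mc
    exact mul_le_mul_of_nonneg_left (mul_le_mul_of_nonneg_left (by linarith only [hmW, hmaj]) hBR) hBG
  have hlead : BG * BR * (12 / 5 * KDA) * S ≤ 4 / 5 * (B₀' * K₁) * S := by
    have h₁ : BG * BR * (12 / 5 * KDA) = 24 / 5 * ((d : ℝ) * (L : ℝ) ^ 2 * BG * BR) * K₁ := by rw [hKDA]; ring
    have h₂ : (d : ℝ) * (L : ℝ) ^ 2 * BG * BR ≤ B₀' / 6 := by linarith only [hfree]
    have h₃ : 24 / 5 * ((d : ℝ) * (L : ℝ) ^ 2 * BG * BR) * K₁ ≤ 24 / 5 * (B₀' / 6) * K₁ :=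
      mul_le_mul_of_nonneg_right (mul_le_mul_of_nonneg_left h₂ (by norm_num)) hK₁.le
    rw [h₁]
    have h₄ := mul_le_mul_of_nonneg_right h₃ hS0
    linarith only [h₄]
  have hrem : 2 * BG * BR * R * S ^ 2 ≤ 6 / 5 * B₀' * K₁ * S := by
    have hden : 0 < 6 / 5 * B₀' * K₁ := by positivity
    have h₁ : 2 * BG * BR * R / (6 / 5 * B₀' * K₁) * S * (6 / 5 * B₀' * K₁) ≤ 1 * (6 / 5 * B₀' * K₁) :=
      mul_le_mul_of_nonneg_right e20 hden.le
    have h₂ : 2 * BG * BR * R / (6 / 5 * B₀' * K₁) * S * (6 / 5 * B₀' * K₁) = 2 * BG * BR * R * S := by field_simp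
    rw [h₂, one_mul] at h₁
    have h₃ := mul_le_mul_of_nonneg_right h₁ hS0
    have e : 2 * BG * BR * R * S * S = 2 * BG * BR * R * S ^ 2 := by ring
    linarith only [h₃, e]
  have e : BG * (BR * (2 * (6 / 5 * KDA * S + R * S ^ 2))) = BG * BR * (12 / 5 * KDA) * S + 2 * BG * BR * R * S ^ 2 := by ring
  linarith only [hM1, e, hlead, hrem, ha]

/-- **(1.106) `B_G·K ≤ ½` at the scales of the assembly** (`K = B_R·2(K_W + 10ℓ₀·B_R·2m_W)`): every term of `K_W`, `m_W` carries a factor `S` (`b₁ ≤ K_b₁S`,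
`c_A ≤ K_bS`, `m_E ≤ K_hE₂S`, `c_DA ≤ K_DA·S`, `K_E ≤ K_lE₂S`, `ℓ₀ = ℓ₁ ≤ 2`, `S² ≤ S`), so `K ≤ K_K·S` with an explicit `K_K` and the window is the threshold
`2B_G·K_K·S ≤ 1`. [cite: Balaban1985RegularSpaces, (1.106) p.94] -/
theorem h106_of_scales {BG BR Kb Kb₁ KhE₂ KDA KlE₂ R KmW KKW KKc S b₁ cA mE cDA KE ℓ : ℝ} (hBG : 0 ≤ BG) (hBR : 0 ≤ BR)
    (hS2 : S ^ 2 ≤ S) (hKb : 0 ≤ Kb) (hKb₁ : 0 ≤ Kb₁)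
    (hb₁0 : 0 ≤ b₁) (hb₁S : b₁ ≤ Kb₁ * S) (hcA0 : 0 ≤ cA) (hcAS : cA ≤ Kb * S) (hmE0 : 0 ≤ mE) (hmES : mE ≤ KhE₂ * S) (hcDA0 : 0 ≤ cDA)
    (hcDAS : cDA ≤ KDA * S) (hKES : KE ≤ KlE₂ * S) (hl0 : 0 ≤ ℓ) (hl1 : ℓ ≤ 2)
    (hR : R = 2 * KhE₂ + d * (82 * Kb₁ ^ 2 + 34 * Kb * Kb₁)) (hKmW : KmW = 6 / 5 * KDA + R)
    (hKKW : KKW = 36 * KDA + 2 * KlE₂ + 20 * KhE₂ + d * (876 * Kb₁ + 3936 * Kb₁ ^ 2 + 136 * Kb + 1616 * Kb * Kb₁))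
    (hKKc : KKc = 2 * BR * (KKW + 40 * BR * KmW)) (e19 : 2 * BG * KKc * S ≤ 1) :
    BG * Kc d BR b₁ cA mE cDA KE ℓ ℓ ≤ 1 / 2 := by
  have hd : (0 : ℝ) ≤ d := Nat.cast_nonneg d
  have hKW : KWc d b₁ cA mE cDA KE ℓ ℓ ≤ KWc d (Kb₁ * S) (Kb * S) (KhE₂ * S) (KDA * S) (KlE₂ * S) 2 2 :=
    KWc_mono hb₁0 hb₁S hcA0 hcAS hmE0 hmES hcDA0 hcDAS hKES hl0 hl1 hl0 hl1
  have hKWmaj : KWc d (Kb₁ * S) (Kb * S) (KhE₂ * S) (KDA * S) (KlE₂ * S) 2 2 ≤ KKW * S := by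
    have e : KWc d (Kb₁ * S) (Kb * S) (KhE₂ * S) (KDA * S) (KlE₂ * S) 2 2 =
        (36 * KDA + 2 * KlE₂ + 20 * KhE₂ + d * (876 * Kb₁ + 136 * Kb)) * S + d * (3936 * Kb₁ ^ 2 + 1616 * Kb * Kb₁) * S ^ 2 := by
      unfold KWc; ring
    rw [e, hKKW]
    have hq : 0 ≤ (d : ℝ) * (3936 * Kb₁ ^ 2 + 1616 * Kb * Kb₁) := by positivity
    have h₁ := mul_le_mul_of_nonneg_left hS2 hq
    have e' : (36 * KDA + 2 * KlE₂ + 20 * KhE₂ + (d : ℝ) * (876 * Kb₁ + 3936 * Kb₁ ^ 2 + 136 * Kb + 1616 * Kb * Kb₁)) * S =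
        (36 * KDA + 2 * KlE₂ + 20 * KhE₂ + d * (876 * Kb₁ + 136 * Kb)) * S + d * (3936 * Kb₁ ^ 2 + 1616 * Kb * Kb₁) * S := by ring
    linarith only [h₁, e']
  have hmW : mWc d b₁ cA mE cDA ≤ mWc d (Kb₁ * S) (Kb * S) (KhE₂ * S) (KDA * S) := mWc_mono hb₁0 hb₁S hcA0 hcAS hmES hcDAS
  have hmWmaj : mWc d (Kb₁ * S) (Kb * S) (KhE₂ * S) (KDA * S) ≤ KmW * S := by
    have e : mWc d (Kb₁ * S) (Kb * S) (KhE₂ * S) (KDA * S) = (6 / 5 * KDA + 2 * KhE₂) * S + d * (82 * Kb₁ ^ 2 + 34 * Kb * Kb₁) * S ^ 2 := by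
      unfold mWc; ring
    rw [e, hKmW, hR]
    have hq : 0 ≤ (d : ℝ) * (82 * Kb₁ ^ 2 + 34 * Kb * Kb₁) := by positivity
    have h₁ := mul_le_mul_of_nonneg_left hS2 hq
    have e' : (6 / 5 * KDA + (2 * KhE₂ + (d : ℝ) * (82 * Kb₁ ^ 2 + 34 * Kb * Kb₁))) * S =
        (6 / 5 * KDA + 2 * KhE₂) * S + d * (82 * Kb₁ ^ 2 + 34 * Kb * Kb₁) * S := by ring
    linarith only [h₁, e']
  have hmW0 : 0 ≤ mWc d b₁ cA mE cDA := by
    unfold mWc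
    have t1 : 0 ≤ (82 : ℝ) * b₁ ^ 2 + 34 * cA * b₁ := by nlinarith only [hb₁0, hcA0]
    nlinarith only [t1, hcDA0, hmE0, hd]
  have hKc : Kc d BR b₁ cA mE cDA KE ℓ ℓ ≤ KKc * S := by
    unfold Kc
    have h₁ : KWc d b₁ cA mE cDA KE ℓ ℓ ≤ KKW * S := hKW.trans hKWmaj
    have h₂ : 10 * ℓ * (BR * (2 * mWc d b₁ cA mE cDA)) ≤ 10 * 2 * (BR * (2 * (KmW * S))) := by
      have ha : BR * (2 * mWc d b₁ cA mE cDA) ≤ BR * (2 * (KmW * S)) :=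
        mul_le_mul_of_nonneg_left (by linarith only [hmW, hmWmaj]) hBR
      have hb : 0 ≤ BR * (2 * mWc d b₁ cA mE cDA) := mul_nonneg hBR (by linarith only [hmW0])
      exact mul_le_mul (by linarith only [hl1]) ha hb (by norm_num)
    have h₃ := mul_le_mul_of_nonneg_left (mul_le_mul_of_nonneg_left (add_le_add h₁ h₂) (show (0 : ℝ) ≤ 2 by norm_num)) hBR
    have e : BR * (2 * (KKW * S + 10 * 2 * (BR * (2 * (KmW * S))))) = KKc * S := by rw [hKKc]; ring
    linarith only [h₃, e]
  have h₁ := mul_le_mul_of_nonneg_left hKc hBG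
  have e : BG * (KKc * S) = (2 * BG * KKc * S) / 2 := by ring
  linarith only [h₁, e, e19]

/-! ## §3 THE WINDOWS FROM ONE GUARD -/

/-- **THEOREM 4's «THERE EXISTS A CONSTANT c₁» FOR THE KNIT WITH THE PROPOSITION-5 SOCKET OPENED** — all 27 scalar windows of
`B8SockHFPAssembly.sockHFP_body_of_join` / `sockHFP₀_body_of_join` from ONE guard.  For `d, L ≥ 1`, `B₀, B₀′ > 0` with `2 ≤ 5dLB₀` (p. 89 «B₁ not too small»), the
[4]-letters constants `B₀′_H > 0`, `B₂′, B_G, B_R ≥ 0`, a b9 threshold `c_b9 > 0`, and THE FREE-CONSTANT CONDITION `3·(2dL²)·B_G·B_R ≤ B₀′` (the socket's `B₀′` absorbs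
the `D*A`-term of (1.99): p. 93 «with RD*A subtracted»), there is `cP > 0` such that for all `α₀, α₁ > 0` with `α₀ + α₁ ≤ cP`, at `c⋆ = 5dLB₀(α₀ + α₁)`,
`α₄ = 8B₀′(5dLB₀)(α₀ + α₁)`, `c_B = L·c⋆` (= `c_A`), `c_DA = 2dL²·c⋆` and the Sect. E sizes `h_E = B₀′_H·C′₂(40d·c_B + α₄)α₄`, `h_E₂ = B₂′·C′₂(40d·c_B + α₄)α₄`,
`l_E = B₀′_H·4C′₂(40d·c_B + 2α₄)`, `l_E₂ = B₂′·4C′₂(40d·c_B + 2α₄)`: Proposition 3's `36dB₀c⋆ ≤ ½`, `8·131072(d+1)²e^{…α₀} ≤ 16·131072(d+1)²`, (1.61) at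
`C₂ = 16·131072(d+1)²`, `dLα₁ ≤ ⅛`; the b9 thresholds `α₀, c⋆ ≤ c_b9`; and the JOIN's `C₀α₀ ≤ ⅓`, `4α₀ ≤ c₂′`, the exponential window at `c_B`, `2c_B ≤ c₃`,
`2048d·c_B ≤ 1`, `40d·c_B ≤ 1/200`, `200C₆·2α₄ ≤ 1`, `12000(d+1)L·2α₄ ≤ 1`, `C₄^G(α₀ + 40d·c_B + 8α₄) ≤ 1`, `1024(d+1)(d+4)L²α₀ ≤ 1`, `32(d+1)²C₆L²α₀ ≤ 1`,
`16dC₅′C₆L²α₀ ≤ 1`, `8dC₆Lα₀ ≤ 1`, `40d·c_B + α₄ ≤ 1/(4B₀′_H·2C′₂)`, `2C₆(40d·c_B + 4α₄) ≤ ⅛`, `c_B ≤ 1/13`, `α₄/4 + h_E ≤ 1/24`, `≤ 1/140`, `10(α₄/4 + h_E)B_R ≤ ½`,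
(1.103) `B_G·M ≤ α₄/4` and (1.106) `B_G·K ≤ ½` (`M = Mc`, `K = Kc` of `B8Prop5ContractionKLevel` at `b₁ = α₄/4 + h_E`, `c_A = c_B`, `m_E = h_E₂`, `K_E = l_E₂`,
`ℓ₀ = ℓ₁ = 1 + l_E`).  Device: `B8Thm4Windows.thm4_windows` (BY NAME) for eighteen of them at `2(L·c⋆) + 8α₄ ≥ c_B`, `mul_le_one_of_le_inv` for the rest.
[cite: Balaban1985RegularSpaces, Thm 4 p.88 («there exists a constant c₁»), (1.102)–(1.103) p.93, (1.106) p.94, Prop. 3 p.87, p.89] -/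
theorem hfpWindows_of_guard (hd : 1 ≤ d) (hL : 1 ≤ L) {B₀ B₀' B₀'H B₂' BG BR cB9 : ℝ} (hB₀ : 0 < B₀) (hB₀' : 0 < B₀')
    (hB : 2 ≤ 5 * (d : ℝ) * L * B₀) (hB₀'H : 0 < B₀'H) (hB₂' : 0 ≤ B₂') (hBG : 0 ≤ BG) (hBR : 0 ≤ BR) (hcB9 : 0 < cB9)
    (hfree : 3 * (2 * (d : ℝ) * (L : ℝ) ^ 2) * BG * BR ≤ B₀') :
    ∃ cP : ℝ, 0 < cP ∧ ∀ α₀ α₁ : ℝ, 0 < α₀ → 0 < α₁ → α₀ + α₁ ≤ cP →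
      ∀ cs α₄ cB cDA hE hE₂ lE lE₂ : ℝ, cs = 5 * (d : ℝ) * L * B₀ * (α₀ + α₁) → α₄ = 8 * B₀' * (5 * (d : ℝ) * L * B₀) * (α₀ + α₁) →
      cB = L * cs → cDA = 2 * (d : ℝ) * (L : ℝ) ^ 2 * cs →
      hE = B₀'H * (C2p d * (40 * d * cB + α₄) * α₄) → hE₂ = B₂' * (C2p d * (40 * d * cB + α₄) * α₄) →
      lE = B₀'H * (4 * C2p d * (40 * d * cB + 2 * α₄)) → lE₂ = B₂' * (4 * C2p d * (40 * d * cB + 2 * α₄)) →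
      -- Proposition 3's four windows not implied by the JOIN's
      36 * d * B₀ * cs ≤ 1 / 2 ∧
      8 * (131072 * ((d : ℝ) + 1) ^ 2) * Real.exp (4 * (800 * ((d : ℝ) + 1) ^ 2 * ((d : ℝ) + 4)) * α₀) ≤ 16 * (131072 * ((d : ℝ) + 1) ^ 2) ∧
      2 * cs ^ 2 + 20 * d * α₀ * cs + 2 * (16 * (131072 * ((d : ℝ) + 1) ^ 2)) * cs ^ 2 ≤ α₀ + α₁ ∧
      (d : ℝ) * L * α₁ ≤ 1 / 8 ∧
      -- the b9 thresholds
      α₀ ≤ cB9 ∧ cs ≤ cB9 ∧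
      -- the JOIN's windows, one-for-one
      C0 d * α₀ ≤ 1 / 3 ∧ 4 * α₀ ≤ c2' d L ∧
      Real.exp (4 * (800 * ((d : ℝ) + 1) ^ 2 * ((d : ℝ) + 4)) * α₀) * (1 + 8 * (131072 * ((d : ℝ) + 1) ^ 2) * cB) ≤ 2 ∧
      2 * cB ≤ c3 d L ∧ 2048 * (d : ℝ) * cB ≤ 1 ∧ 40 * d * cB ≤ 1 / 200 ∧
      200 * C6 d * (2 * α₄) ≤ 1 ∧ 12000 * ((d : ℝ) + 1) * L * (2 * α₄) ≤ 1 ∧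
      C4G d L * (α₀ + 40 * d * cB + 4 * (2 * α₄)) ≤ 1 ∧
      1024 * ((d : ℝ) + 1) * ((d : ℝ) + 4) * L ^ 2 * α₀ ≤ 1 ∧ 32 * ((d : ℝ) + 1) ^ 2 * C6 d * L ^ 2 * α₀ ≤ 1 ∧
      16 * d * C5' d * C6 d * (L : ℝ) ^ 2 * α₀ ≤ 1 ∧ 8 * d * C6 d * L * α₀ ≤ 1 ∧
      40 * d * cB + α₄ ≤ 1 / (4 * B₀'H * (2 * C2p d)) ∧ 2 * C6 d * (40 * d * cB + 4 * α₄) ≤ 1 / 8 ∧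
      cB ≤ 1 / 13 ∧ α₄ / 4 + hE ≤ 1 / 24 ∧ α₄ / 4 + hE ≤ 1 / 140 ∧ 10 * (α₄ / 4 + hE) * BR ≤ 1 / 2 ∧
      BG * Mc d BR (α₄ / 4 + hE) cB hE₂ cDA ≤ α₄ / 4 ∧
      BG * Kc d BR (α₄ / 4 + hE) cB hE₂ cDA lE₂ (1 + lE) (1 + lE) ≤ 1 / 2 := by
  -- shorthand
  have hd' : (1 : ℝ) ≤ d := by exact_mod_cast hd
  have hL' : (1 : ℝ) ≤ L := by exact_mod_cast hL
  have hd0 : (0 : ℝ) < d := by linarith only [hd']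
  have hL0 : (0 : ℝ) < L := by linarith only [hL']
  have hC6 : (2 : ℝ) ≤ C6 d := two_le_C6'
  have hC60 : (0 : ℝ) ≤ C6 d := by linarith only [hC6]
  have hC2 : 0 < C2p d := C2p_pos
  have hC4 : 0 ≤ C4G d L := (C4G_pos' d L).le
  have hC5 : (0 : ℝ) ≤ C5' d := C5'_nonneg
  -- Theorem 4's eighteen windows (n05-a) below `c₁`
  obtain ⟨c₁, hc₁, hw4⟩ := thm4_windows hd hL hB₀ hB₀' hB
  -- the scales: c⋆ = K₁S, c_B = KbS, α₄ = K₄S, c_DA = KDA·S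
  obtain ⟨K₁, hK₁⟩ : ∃ K₁ : ℝ, K₁ = 5 * d * L * B₀ := ⟨_, rfl⟩
  obtain ⟨Kb, hKb⟩ : ∃ Kb : ℝ, Kb = L * K₁ := ⟨_, rfl⟩
  obtain ⟨K₄, hK₄⟩ : ∃ K₄ : ℝ, K₄ = 8 * B₀' * K₁ := ⟨_, rfl⟩
  obtain ⟨KDA, hKDA⟩ : ∃ KDA : ℝ, KDA = 2 * d * (L : ℝ) ^ 2 * K₁ := ⟨_, rfl⟩
  have hK₁0 : 0 < K₁ := by rw [hK₁]; positivity
  have hKb0 : 0 < Kb := by rw [hKb]; positivity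
  have hK₄0 : 0 < K₄ := by rw [hK₄]; positivity
  have hKDA0 : 0 < KDA := by rw [hKDA]; positivity
  -- the Sect. E sizes per unit S (resp. S²): hE = KhE·S², lE = KlE·S
  obtain ⟨KhE, hKhE⟩ : ∃ KhE : ℝ, KhE = B₀'H * (C2p d * (40 * d * Kb + K₄) * K₄) := ⟨_, rfl⟩
  obtain ⟨KhE₂, hKhE₂⟩ : ∃ KhE₂ : ℝ, KhE₂ = B₂' * (C2p d * (40 * d * Kb + K₄) * K₄) := ⟨_, rfl⟩
  obtain ⟨KlE, hKlE⟩ : ∃ KlE : ℝ, KlE = B₀'H * (4 * C2p d * (40 * d * Kb + 2 * K₄)) := ⟨_, rfl⟩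
  obtain ⟨KlE₂, hKlE₂⟩ : ∃ KlE₂ : ℝ, KlE₂ = B₂' * (4 * C2p d * (40 * d * Kb + 2 * K₄)) := ⟨_, rfl⟩
  have hKhE0 : 0 ≤ KhE := by rw [hKhE]; positivity
  have hKhE₂0 : 0 ≤ KhE₂ := by rw [hKhE₂]; positivity
  have hKlE0 : 0 ≤ KlE := by rw [hKlE]; positivity
  have hKlE₂0 : 0 ≤ KlE₂ := by rw [hKlE₂]; positivity
  -- the majorants of b₁ = α₄/4 + hE, of m_W and of K_W per unit S
  obtain ⟨Kb₁, hKb₁⟩ : ∃ Kb₁ : ℝ, Kb₁ = K₄ / 4 + KhE := ⟨_, rfl⟩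
  have hKb₁0 : 0 ≤ Kb₁ := by rw [hKb₁]; positivity
  obtain ⟨R, hR⟩ : ∃ R : ℝ, R = 2 * KhE₂ + d * (82 * Kb₁ ^ 2 + 34 * Kb * Kb₁) := ⟨_, rfl⟩
  have hR0 : 0 ≤ R := by rw [hR]; positivity
  obtain ⟨KmW, hKmW⟩ : ∃ KmW : ℝ, KmW = 6 / 5 * KDA + R := ⟨_, rfl⟩
  have hKmW0 : 0 ≤ KmW := by rw [hKmW]; positivity
  obtain ⟨KKW, hKKW⟩ : ∃ KKW : ℝ, KKW = 36 * KDA + 2 * KlE₂ + 20 * KhE₂ + d * (876 * Kb₁ + 3936 * Kb₁ ^ 2 + 136 * Kb + 1616 * Kb * Kb₁) := ⟨_, rfl⟩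
  have hKKW0 : 0 ≤ KKW := by rw [hKKW]; positivity
  obtain ⟨KKc, hKKc⟩ : ∃ KKc : ℝ, KKc = 2 * BR * (KKW + 40 * BR * KmW) := ⟨_, rfl⟩
  have hKKc0 : 0 ≤ KKc := by rw [hKKc]; positivity
  -- the coefficients of the new windows
  obtain ⟨D1, hD1⟩ : ∃ D1 : ℝ, D1 = 1 / cB9 := ⟨_, rfl⟩
  obtain ⟨D2, hD2⟩ : ∃ D2 : ℝ, D2 = K₁ / cB9 := ⟨_, rfl⟩
  obtain ⟨D3, hD3⟩ : ∃ D3 : ℝ, D3 = 8 * d * L := ⟨_, rfl⟩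
  obtain ⟨D4, hD4⟩ : ∃ D4 : ℝ, D4 = 8000 * d * Kb := ⟨_, rfl⟩
  obtain ⟨D5, hD5⟩ : ∃ D5 : ℝ, D5 = 400 * C6 d * K₄ := ⟨_, rfl⟩
  obtain ⟨D6, hD6⟩ : ∃ D6 : ℝ, D6 = 24000 * ((d : ℝ) + 1) * L * K₄ := ⟨_, rfl⟩
  obtain ⟨D7, hD7⟩ : ∃ D7 : ℝ, D7 = C4G d L * (1 + 40 * d * Kb + 8 * K₄) := ⟨_, rfl⟩
  obtain ⟨D8, hD8⟩ : ∃ D8 : ℝ, D8 = 1024 * ((d : ℝ) + 1) * ((d : ℝ) + 4) * L ^ 2 := ⟨_, rfl⟩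
  obtain ⟨D9, hD9⟩ : ∃ D9 : ℝ, D9 = 32 * ((d : ℝ) + 1) ^ 2 * C6 d * L ^ 2 := ⟨_, rfl⟩
  obtain ⟨D10, hD10⟩ : ∃ D10 : ℝ, D10 = 16 * d * C5' d * C6 d * (L : ℝ) ^ 2 := ⟨_, rfl⟩
  obtain ⟨D11, hD11⟩ : ∃ D11 : ℝ, D11 = 8 * d * C6 d * L := ⟨_, rfl⟩
  obtain ⟨D12, hD12⟩ : ∃ D12 : ℝ, D12 = (40 * d * Kb + K₄) * (8 * B₀'H * C2p d) := ⟨_, rfl⟩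
  obtain ⟨D13, hD13⟩ : ∃ D13 : ℝ, D13 = 16 * C6 d * (40 * d * Kb + 4 * K₄) := ⟨_, rfl⟩
  obtain ⟨D14, hD14⟩ : ∃ D14 : ℝ, D14 = 13 * Kb := ⟨_, rfl⟩
  obtain ⟨D15, hD15⟩ : ∃ D15 : ℝ, D15 = 1 := ⟨_, rfl⟩
  obtain ⟨D16, hD16⟩ : ∃ D16 : ℝ, D16 = 140 * Kb₁ := ⟨_, rfl⟩
  obtain ⟨D17, hD17⟩ : ∃ D17 : ℝ, D17 = 20 * BR * Kb₁ := ⟨_, rfl⟩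
  obtain ⟨D18, hD18⟩ : ∃ D18 : ℝ, D18 = KlE := ⟨_, rfl⟩
  obtain ⟨D19, hD19⟩ : ∃ D19 : ℝ, D19 = 2 * BG * KKc := ⟨_, rfl⟩
  obtain ⟨D20, hD20⟩ : ∃ D20 : ℝ, D20 = 2 * BG * BR * R / (6 / 5 * B₀' * K₁) := ⟨_, rfl⟩
  have h1 : 0 ≤ D1 := by rw [hD1]; positivity
  have h2 : 0 ≤ D2 := by rw [hD2]; positivity
  have h3 : 0 ≤ D3 := by rw [hD3]; positivity
  have h4 : 0 ≤ D4 := by rw [hD4]; positivity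
  have h5 : 0 ≤ D5 := by rw [hD5]; positivity
  have h6 : 0 ≤ D6 := by rw [hD6]; positivity
  have h7 : 0 ≤ D7 := by rw [hD7]; positivity
  have h8 : 0 ≤ D8 := by rw [hD8]; positivity
  have h9 : 0 ≤ D9 := by rw [hD9]; positivity
  have h10 : 0 ≤ D10 := by rw [hD10]; positivity
  have h11 : 0 ≤ D11 := by rw [hD11]; positivity
  have h12 : 0 ≤ D12 := by rw [hD12]; positivity
  have h13 : 0 ≤ D13 := by rw [hD13]; positivity
  have h14 : 0 ≤ D14 := by rw [hD14]; positivity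
  have h15 : 0 ≤ D15 := by rw [hD15]; norm_num
  have h16 : 0 ≤ D16 := by rw [hD16]; positivity
  have h17 : 0 ≤ D17 := by rw [hD17]; positivity
  have h18 : 0 ≤ D18 := by rw [hD18]; positivity
  have h19 : 0 ≤ D19 := by rw [hD19]; positivity
  have h20 : 0 ≤ D20 := by rw [hD20]; positivity
  -- one threshold per coefficient: `S ≤ 1/(Dᵢ + 1)` gives `Dᵢ·S ≤ 1`
  have tpos : ∀ {D : ℝ}, 0 ≤ D → 0 < 1 / (D + 1) := fun h => by positivity
  obtain ⟨T, hT⟩ : ∃ T : ℝ, T = min (1 / (D1 + 1)) (min (1 / (D2 + 1)) (min (1 / (D3 + 1)) (min (1 / (D4 + 1)) (min (1 / (D5 + 1)) (min (1 / (D6 + 1)) (min (1 / (D7 + 1)) (min (1 / (D8 + 1)) (min (1 / (D9 + 1)) (min (1 / (D10 + 1)) (min (1 / (D11 + 1)) (min (1 / (D12 + 1)) (min (1 / (D13 + 1)) (min (1 / (D14 + 1)) (min (1 / (D15 + 1)) (min (1 / (D16 + 1)) (min (1 / (D17 + 1)) (min (1 / (D18 + 1)) (min (1 / (D19 + 1))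 (1 / (D20 + 1)))))))))))))))))))) := ⟨_, rfl⟩
  have hT0 : 0 < T := by
    rw [hT]
    exact lt_min (tpos h1) (lt_min (tpos h2) (lt_min (tpos h3) (lt_min (tpos h4) (lt_min (tpos h5) (lt_min (tpos h6) (lt_min (tpos h7) (lt_min (tpos h8) (lt_min (tpos h9) (lt_min (tpos h10) (lt_min (tpos h11) (lt_min (tpos h12) (lt_min (tpos h13) (lt_min (tpos h14) (lt_min (tpos h15) (lt_min (tpos h16) (lt_min (tpos h17) (lt_min (tpos h18) (lt_min (tpos h19) (tpos h20)))))))))))))))))))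
  refine ⟨min c₁ T, lt_min hc₁ hT0, ?_⟩
  intro α₀ α₁ hα₀ hα₁ hguard cs α₄ cB cDA hE hE₂ lE lE₂ hcs hα₄ hcB hcDA hhE hhE₂ hlE hlE₂
  have hS₁ : α₀ + α₁ ≤ c₁ := hguard.trans (min_le_left _ _)
  have hS : α₀ + α₁ ≤ T := hguard.trans (min_le_right _ _)
  -- Theorem 4's windows at (c⋆, α₄)
  obtain ⟨w1, w2, w3, w4, w5, w6, w7, w8, w9, w10, w11, w12, w13, w14, w15, w16, w17, w18⟩ := hw4 α₀ α₁ hα₀ hα₁ hS₁ cs α₄ hcs hα₄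
  obtain ⟨S, hSdef⟩ : ∃ S : ℝ, S = α₀ + α₁ := ⟨_, rfl⟩
  rw [← hSdef] at hS
  have hS0 : 0 ≤ S := by rw [hSdef]; linarith only [hα₀, hα₁]
  have hSpos : 0 < S := by rw [hSdef]; linarith only [hα₀, hα₁]
  have hα₀S : α₀ ≤ S := by rw [hSdef]; linarith only [hα₁]
  have hα₁S : α₁ ≤ S := by rw [hSdef]; linarith only [hα₀]
  -- the scales in terms of S
  have hcsS : cs = K₁ * S := by rw [hcs, hK₁, hSdef]
  have hcBS : cB = Kb * S := by rw [hcB, hcsS, hKb]; ring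
  have hα₄S : α₄ = K₄ * S := by rw [hα₄, hK₄, hK₁, hSdef]
  have hcDAS : cDA = KDA * S := by rw [hcDA, hcsS, hKDA]; ring
  have hES : hE = KhE * S ^ 2 := by rw [hhE, hcBS, hα₄S, hKhE]; ring
  have hE₂S : hE₂ = KhE₂ * S ^ 2 := by rw [hhE₂, hcBS, hα₄S, hKhE₂]; ring
  have hlES : lE = KlE * S := by rw [hlE, hcBS, hα₄S, hKlE]; ring
  have hlE₂S : lE₂ = KlE₂ * S := by rw [hlE₂, hcBS, hα₄S, hKlE₂]; ring
  have hcs0 : 0 ≤ cs := by rw [hcsS]; positivity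
  have hcB0 : 0 ≤ cB := by rw [hcBS]; positivity
  have hα₄0 : 0 ≤ α₄ := by rw [hα₄S]; positivity
  have hcDA0 : 0 ≤ cDA := by rw [hcDAS]; positivity
  have hhE0 : 0 ≤ hE := by rw [hES]; positivity
  have hhE₂0 : 0 ≤ hE₂ := by rw [hE₂S]; positivity
  have hlE0 : 0 ≤ lE := by rw [hlES]; positivity
  -- `c⋆ ≤ c_B ≤ 2(L·c⋆) + 8α₄`
  have hcsB : cs ≤ cB := by rw [hcB]; exact le_mul_of_one_le_left hcs0 hL'
  have hcBX : cB ≤ 2 * (L * cs) + 8 * α₄ := by rw [hcB]; nlinarith only [hcs0, hα₄0, hL0]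
  have hcsX : cs ≤ 2 * (L * cs) + 8 * α₄ := hcsB.trans hcBX
  -- peel the thresholds: `Dᵢ·S ≤ 1`
  have dev : ∀ {D : ℝ}, 0 ≤ D → S ≤ 1 / (D + 1) → D * S ≤ 1 := fun {D} hD h =>
    mul_le_one_of_le_inv (by linarith only [hD] : D ≤ D + 1) (by linarith only [hD]) hS0 h
  rw [hT] at hS
  have e1 : D1 * S ≤ 1 := dev h1 (hS.trans (min_le_left _ _))
  have hT2 := hS.trans (min_le_right _ _)
  have e2 : D2 * S ≤ 1 := dev h2 (hT2.trans (min_le_left _ _))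
  have hT3 := hT2.trans (min_le_right _ _)
  have e3 : D3 * S ≤ 1 := dev h3 (hT3.trans (min_le_left _ _))
  have hT4 := hT3.trans (min_le_right _ _)
  have e4 : D4 * S ≤ 1 := dev h4 (hT4.trans (min_le_left _ _))
  have hT5 := hT4.trans (min_le_right _ _)
  have e5 : D5 * S ≤ 1 := dev h5 (hT5.trans (min_le_left _ _))
  have hT6 := hT5.trans (min_le_right _ _)
  have e6 : D6 * S ≤ 1 := dev h6 (hT6.trans (min_le_left _ _))
  have hT7 := hT6.trans (min_le_right _ _)
  have e7 : D7 * S ≤ 1 := dev h7 (hT7.trans (min_le_left _ _))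
  have hT8 := hT7.trans (min_le_right _ _)
  have e8 : D8 * S ≤ 1 := dev h8 (hT8.trans (min_le_left _ _))
  have hT9 := hT8.trans (min_le_right _ _)
  have e9 : D9 * S ≤ 1 := dev h9 (hT9.trans (min_le_left _ _))
  have hT10 := hT9.trans (min_le_right _ _)
  have e10 : D10 * S ≤ 1 := dev h10 (hT10.trans (min_le_left _ _))
  have hT11 := hT10.trans (min_le_right _ _)
  have e11 : D11 * S ≤ 1 := dev h11 (hT11.trans (min_le_left _ _))
  have hT12 := hT11.trans (min_le_right _ _)
  have e12 : D12 * S ≤ 1 := dev h12 (hT12.trans (min_le_left _ _))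
  have hT13 := hT12.trans (min_le_right _ _)
  have e13 : D13 * S ≤ 1 := dev h13 (hT13.trans (min_le_left _ _))
  have hT14 := hT13.trans (min_le_right _ _)
  have e14 : D14 * S ≤ 1 := dev h14 (hT14.trans (min_le_left _ _))
  have hT15 := hT14.trans (min_le_right _ _)
  have e15 : D15 * S ≤ 1 := dev h15 (hT15.trans (min_le_left _ _))
  have hT16 := hT15.trans (min_le_right _ _)
  have e16 : D16 * S ≤ 1 := dev h16 (hT16.trans (min_le_left _ _))
  have hT17 := hT16.trans (min_le_right _ _)
  have e17 : D17 * S ≤ 1 := dev h17 (hT17.trans (min_le_left _ _))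
  have hT18 := hT17.trans (min_le_right _ _)
  have e18 : D18 * S ≤ 1 := dev h18 (hT18.trans (min_le_left _ _))
  have hT19 := hT18.trans (min_le_right _ _)
  have e19 : D19 * S ≤ 1 := dev h19 (hT19.trans (min_le_left _ _))
  have e20 : D20 * S ≤ 1 := dev h20 (hT19.trans (min_le_right _ _))
  -- `S ≤ 1`, `S² ≤ S`, `lE ≤ 1`
  have hS1 : S ≤ 1 := by rw [hD15] at e15; linarith only [e15]
  have hS2 : S ^ 2 ≤ S := by nlinarith only [hS0, hS1]
  have hlE1 : lE ≤ 1 := by rw [hlES, ← hD18]; exact e18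
  -- `b₁ = α₄/4 + hE ≤ Kb₁·S`, `hE₂ ≤ KhE₂·S`
  have hb₁S : α₄ / 4 + hE ≤ Kb₁ * S := by
    rw [hα₄S, hES, hKb₁]
    nlinarith only [hS2, hKhE0, hK₄0.le, hS0]
  have hb₁0 : 0 ≤ α₄ / 4 + hE := by positivity
  have hE₂S' : hE₂ ≤ KhE₂ * S := by rw [hE₂S]; nlinarith only [hS2, hKhE₂0]
  refine ⟨?_, w13, ?_, ?_, ?_, ?_, w5, w6, ?_, ?_, ?_, ?_, ?_, ?_, ?_, ?_, ?_, ?_, ?_, ?_, ?_, ?_, ?_, ?_, ?_, ?_, ?_⟩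
  · -- 36 d B₀ c⋆ ≤ 1/2
    have h₁ : 36 * d * B₀ * cs ≤ 36 * d * B₀ * (2 * (L * cs) + 8 * α₄) := mul_le_mul_of_nonneg_left hcsX (by positivity)
    exact h₁.trans w11
  · -- (1.61) at c⋆ from (1.61) at 2(Lc⋆) + 8α₄
    have hX0 : 0 ≤ 2 * (L * cs) + 8 * α₄ := hcs0.trans hcsX
    have h₁ : cs ^ 2 ≤ (2 * (L * cs) + 8 * α₄) ^ 2 := pow_le_pow_left₀ hcs0 hcsX 2
    have h₂ : 20 * d * α₀ * cs ≤ 20 * d * α₀ * (2 * (L * cs) + 8 * α₄) := mul_le_mul_of_nonneg_left hcsX (by positivity)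
    have h₃ : 2 * (16 * (131072 * ((d : ℝ) + 1) ^ 2)) * cs ^ 2 ≤ 2 * (16 * (131072 * ((d : ℝ) + 1) ^ 2)) * (2 * (L * cs) + 8 * α₄) ^ 2 :=
      mul_le_mul_of_nonneg_left h₁ (by positivity)
    linarith only [h₁, h₂, h₃, w14]
  · -- dLα₁ ≤ 1/8
    rw [hD3] at e3
    have h₁ : (d : ℝ) * L * α₁ ≤ d * L * S := mul_le_mul_of_nonneg_left hα₁S (by positivity)
    linarith only [h₁, e3]
  · -- α₀ ≤ c_b9
    rw [hD1] at e1
    have h₁ : 1 / cB9 * S * cB9 ≤ 1 * cB9 := mul_le_mul_of_nonneg_right e1 hcB9.le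
    have h₂ : 1 / cB9 * S * cB9 = S := by field_simp
    linarith only [h₁, h₂, hα₀S]
  · -- c⋆ ≤ c_b9
    rw [hD2] at e2
    have h₁ : K₁ / cB9 * S * cB9 ≤ 1 * cB9 := mul_le_mul_of_nonneg_right e2 hcB9.le
    have h₂ : K₁ / cB9 * S * cB9 = K₁ * S := by field_simp
    rw [hcsS]; linarith only [h₁, h₂]
  · -- exp window at c_B
    have hexp0 : 0 ≤ Real.exp (4 * (800 * ((d : ℝ) + 1) ^ 2 * ((d : ℝ) + 4)) * α₀) := (Real.exp_pos _).le
    have h₁ : 1 + 8 * (131072 * ((d : ℝ) + 1) ^ 2) * cB ≤ 1 + 8 * (131072 * ((d : ℝ) + 1) ^ 2) * (2 * (L * cs) + 8 * α₄) := by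
      have := mul_le_mul_of_nonneg_left hcBX (show (0 : ℝ) ≤ 8 * (131072 * ((d : ℝ) + 1) ^ 2) by positivity)
      linarith only [this]
    exact (mul_le_mul_of_nonneg_left h₁ hexp0).trans w9
  · -- 2c_B ≤ c₃
    linarith only [hcBX, w10]
  · -- 2048 d c_B ≤ 1
    rw [hD4] at e4
    have e : 8000 * (d : ℝ) * Kb * S = 8000 * (d * cB) := by rw [hcBS]; ring
    rw [e] at e4
    have hdc : 0 ≤ (d : ℝ) * cB := by positivity
    linarith only [e4, hdc]
  · -- 40 d c_B ≤ 1/200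
    rw [hD4] at e4
    have e : 8000 * (d : ℝ) * Kb * S = 8000 * (d * cB) := by rw [hcBS]; ring
    rw [e] at e4
    linarith only [e4]
  · -- 200 C₆ (2α₄) ≤ 1
    rw [hD5] at e5
    have e : 400 * C6 d * K₄ * S = 200 * C6 d * (2 * α₄) := by rw [hα₄S]; ring
    linarith only [e5, e]
  · -- 12000(d+1)L(2α₄) ≤ 1
    rw [hD6] at e6
    have e : 24000 * ((d : ℝ) + 1) * L * K₄ * S = 12000 * ((d : ℝ) + 1) * L * (2 * α₄) := by rw [hα₄S]; ring
    linarith only [e6, e]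
  · -- C₄^G (α₀ + 40 d c_B + 8α₄) ≤ 1
    rw [hD7] at e7
    have h₁ : α₀ + 40 * d * cB + 4 * (2 * α₄) ≤ (1 + 40 * d * Kb + 8 * K₄) * S := by
      rw [hcBS, hα₄S]; nlinarith only [hα₀S, hS0]
    have h₂ := mul_le_mul_of_nonneg_left h₁ hC4
    have e : C4G d L * ((1 + 40 * d * Kb + 8 * K₄) * S) = C4G d L * (1 + 40 * d * Kb + 8 * K₄) * S := by ring
    linarith only [h₂, e7, e]
  · -- 1024(d+1)(d+4)L²α₀ ≤ 1
    rw [hD8] at e8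
    have h₁ : 1024 * ((d : ℝ) + 1) * ((d : ℝ) + 4) * L ^ 2 * α₀ ≤ 1024 * ((d : ℝ) + 1) * ((d : ℝ) + 4) * L ^ 2 * S :=
      mul_le_mul_of_nonneg_left hα₀S (by positivity)
    linarith only [h₁, e8]
  · -- 32(d+1)²C₆L²α₀ ≤ 1
    rw [hD9] at e9
    have h₁ : 32 * ((d : ℝ) + 1) ^ 2 * C6 d * L ^ 2 * α₀ ≤ 32 * ((d : ℝ) + 1) ^ 2 * C6 d * L ^ 2 * S :=
      mul_le_mul_of_nonneg_left hα₀S (by positivity)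
    linarith only [h₁, e9]
  · -- 16 d C₅′ C₆ L² α₀ ≤ 1
    rw [hD10] at e10
    have h₁ : 16 * d * C5' d * C6 d * (L : ℝ) ^ 2 * α₀ ≤ 16 * d * C5' d * C6 d * (L : ℝ) ^ 2 * S :=
      mul_le_mul_of_nonneg_left hα₀S (by positivity)
    linarith only [h₁, e10]
  · -- 8 d C₆ L α₀ ≤ 1
    rw [hD11] at e11
    have h₁ : 8 * d * C6 d * L * α₀ ≤ 8 * d * C6 d * L * S := mul_le_mul_of_nonneg_left hα₀S (by positivity)
    linarith only [h₁, e11]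
  · -- 40 d c_B + α₄ ≤ 1/(4B₀′_H·2C′₂)
    rw [hD12] at e12
    have hden : 0 < 4 * B₀'H * (2 * C2p d) := by positivity
    rw [le_div_iff₀ hden]
    have e : (40 * d * Kb + K₄) * (8 * B₀'H * C2p d) * S = (40 * d * cB + α₄) * (4 * B₀'H * (2 * C2p d)) := by
      rw [hcBS, hα₄S]; ring
    linarith only [e12, e]
  · -- 2C₆(40 d c_B + 4α₄) ≤ 1/8
    rw [hD13] at e13
    have e : 16 * C6 d * (40 * d * Kb + 4 * K₄) * S = 8 * (2 * C6 d * (40 * d * cB + 4 * α₄)) := by rw [hcBS, hα₄S]; ring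
    linarith only [e13, e]
  · -- c_B ≤ 1/13
    rw [hD14] at e14
    have e : 13 * Kb * S = 13 * cB := by rw [hcBS]; ring
    linarith only [e14, e]
  · -- α₄/4 + hE ≤ 1/24
    rw [hD16] at e16
    nlinarith only [hb₁S, e16, hKb₁0, hS0]
  · -- α₄/4 + hE ≤ 1/140
    rw [hD16] at e16
    nlinarith only [hb₁S, e16, hKb₁0, hS0]
  · -- 10(α₄/4 + hE)B_R ≤ 1/2
    rw [hD17] at e17
    have h₁ : 10 * (α₄ / 4 + hE) * BR ≤ 10 * (Kb₁ * S) * BR :=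
      mul_le_mul_of_nonneg_right (mul_le_mul_of_nonneg_left hb₁S (by norm_num)) hBR
    have e : 10 * (Kb₁ * S) * BR = (20 * BR * Kb₁ * S) / 2 := by ring
    linarith only [h₁, e, e17]
  · -- (1.103): B_G·M ≤ α₄/4 (§2 `h103_of_scales`)
    rw [hD20] at e20
    exact h103_of_scales hBG hBR hB₀' hK₁0 hS0 hfree hKDA hb₁0 hb₁S hcB0 hcBS.le hE₂S.le hcDAS.le hR e20 (by rw [hα₄S, hK₄]; ring)
  · -- (1.106): B_G·K ≤ 1/2 (§2 `h106_of_scales`)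
    rw [hD19] at e19
    exact h106_of_scales hBG hBR hS2 hKb0.le hKb₁0 hb₁0 hb₁S hcB0 hcBS.le hhE₂0 hE₂S' hcDA0 hcDAS.le hlE₂S.le (by positivity)
      (by linarith only [hlE1]) hR hKmW hKKW hKKc e19

#print axioms hfpWindows_of_guard

end Literature.MathematicalPhysics.QuantumFieldTheory.Balaban1983to89.B8SockHFPWindows

end
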